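import Literature.NumberTheory.EllipticCurves.ModularSymbolsHeckeProofs
import Literature.NumberTheory.EllipticCurves.ModularSymbolsProofs
import Mathlib.Analysis.SpecialFunctions.ImproperIntegrals
import Mathlib.MeasureTheory.Integral.IntegralEqImproper
import HarnessLib

/-!
# Two-sided series for the twisted modular-symbol sums `∑ χ̄(a) {∞, a/m}_f` (weight 2)

Topic `NumberTheory/EllipticCurves` (modular symbols of `f ∈ S_2(Γ₀(N))`, items C6/C9 of trunk
EllArithM; companion of `ModularSymbolsHeckeProofs`). For a cusp form `f = ∑ aₙ qⁿ ∈ S_2(Γ₀(N))`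
which is an eigenfunction of the Fricke involution, `f(-1/(Nτ)) = ε N τ² f(τ)` (`ε = ±1` for a
newform, Atkin–Lehner 1970, Thm. 3), the modular symbols `{∞, u/m}_f = 2π ∫₀^∞ f(u/m + it) dt`
at cusps `u/m` with `(u, m) = 1`, `(m, N) = 1` admit the classical **two-sided rapidly convergent
series** (the weight-`2` "approximate functional equation" in exact form, as used by Rohrlich
1984, §2, and in Cremona's algorithms, 1997, §2.10): for every `Y > 0`,

`{∞, u/m}_f = ∑_{n ≥ 1} (aₙ/n) e(nu/m) e^{-2πnY} - ε ∑_{n ≥ 1} (aₙ/n) e(nv/m) e^{-2πn/(N m² Y)}`,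

where `v ≡ -(uN)⁻¹ (mod m)`. It comes from the matrix identity
`[1, u/m; 0, 1] w_{Nm²} = m · γ · w_N · [1, v/m; 0, 1]` with `γ = (a u; Nv m) ∈ Γ₀(N)`,
`a m - u N v = 1`, which on the level of points reads
`f(u/m + it) = -ε f(v/m + i/(N m² t)) / (N m² t²)` (`apply_ofComplex_eq_of_isFrickeEigen`).
Summing against a primitive Dirichlet character `χ` mod `m` and evaluating the two Gauss sums
gives the two-sided series for the twisted symbol sums (`twistedSymbolSum`, whose value is
`τ(χ̄) L(f, χ, 1)` by Birch's formula `twisted_LValue_eq`):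

* `Literature.NumberTheory.EllipticCurves.ModularForms.twistedSymbolSum_inv_eq_dampedTwist`:
  `∑_a χ̄(a) {∞, a/m}_f = τ(χ̄) D_f(χ, Y) - ε χ̄(-1) χ(N) τ(χ) D_f(χ̄, 1/(N m² Y))`,
  `D_f(w, y) = ∑_{n ≥ 1} w(n) aₙ e^{-2πny}/n` (`dampedTwist`).

This is the analytic input of the first-moment non-vanishing theorem for `L(f ⊗ χ, 1)` over the
characters of `p`-power conductor (`PAdicLFunctionMomentProofs`), which replaces Rohrlich's
theorem in the proof of `L_p(E, T) ≠ 0` (`padicLFunction_ne_zero`).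

## Contents

* `hasSum_integral_Ioi_imagAxis`: `∫_Y^∞ g(it) dt = ∑ aₙ e^{-2πnY}/(2πn)` for a cusp form `g`
  (`1` a strict period), by termwise integration of the `q`-expansion.
* `frickePoint`, `IsFrickeEigen`: `w_N τ = -1/(Nτ)` and the pointwise eigen-property.
* `apply_ofComplex_eq_of_isFrickeEigen`: the flip `u/m + it ↔ v/m + i/(N m² t)`.
* `setIntegral_Ioc_eq_of_flip`: the substitution `t = 1/(N m² s)` on `(0, Y]`.
* `dampedTwist`, `rayTail`, `hasSum_rayTail`, `modularSymbol_eq_rayTail_sub`: the two-sided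
  series for `{∞, u/m}_f`.
* `sum_inv_mul_stdAddChar_flip`, `twistedSymbolSum_inv_eq_dampedTwist`: the finite Fourier
  analysis and the main identity.
* `IsFrickePair`, `apply_ofComplex_eq_of_isFrickePair`,
  `modularSymbol_eq_rayTail_sub_of_isFrickePair`,
  `twistedSymbolSum_inv_eq_dampedTwist_of_isFrickePair`: the same for a **Fricke pair**
  `f(-1/(Nτ)) = N τ² g(τ)` (`g = w_N f`, no eigen-assumption): the dual side carries `D_g`.

## Design notes

* The Fricke eigen-property is taken *pointwise* (`IsFrickeEigen N f ε`), the form in which it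
  is used; for a newform it follows from the named facts `IsNewform0.frickeInvolution_eq_smul`
  and `frickeInvolution_apply_eq_slash` of `CuspFormLFunction` (Atkin–Lehner 1970, Thm. 3).
  No use is made of `ε² = 1`.
* The Fricke-pair versions (section `FrickePair`) remove the eigen-assumption altogether: for
  any `f ∈ S_2(Γ₀(N))`, `(f, w_N f)` is a Fricke pair, so the first-moment method applies to
  the newform of an elliptic curve without Atkin–Lehner's Theorem 3.
* No functional equation of `L(f ⊗ χ, s)` and no cusp-form structure on the twist `f_χ` is
  needed: everything is reduced to the translates `f(· + q)` of `ModularSymbolsHeckeProofs`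
  (`translateCuspForm`, `hasSum_imagAxis`) and Mathlib's change-of-variables lemmas on `(0, ∞)`
  (`integral_comp_rpow_Ioi`, `integral_comp_mul_left_Ioi`).

## References

* D. E. Rohrlich, *On `L`-functions of elliptic curves and cyclotomic towers*, Invent. Math. 75
  (1984), 409–423, §2.
* J. E. Cremona, *Algorithms for modular elliptic curves*, 2nd ed., CUP 1997, §2.8, §2.10.
* G. Shimura, *Introduction to the arithmetic theory of automorphic functions*, 1971, Thm. 3.66.
* A. O. L. Atkin, J. Lehner, *Hecke operators on `Γ₀(m)`*, Math. Ann. 185 (1970), §2, Thm. 3.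
* A. O. L. Atkin, W. Li, *Twists of newforms and pseudo-eigenvalues of `W`-operators*,
  Invent. Math. 48 (1978), (1.1).
* B. J. Birch, *Elliptic curves over `ℚ`: a progress report*, Proc. Sympos. Pure Math. 20 (1971).
-/

noncomputable section

open scoped MatrixGroups ModularForm Manifold Real

open CongruenceSubgroup UpperHalfPlane Complex Filter Topology Asymptotics Set MeasureTheory
  Matrix.GeneralLinearGroup ConjAct Pointwise

namespace Literature.NumberTheory.EllipticCurves.ModularForms

/-! ### Tails of the ray integrals: `2π ∫_Y^∞ g(it) dt = ∑ aₙ e^{-2πnY}/n` -/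

section Tail

variable {Γ : Subgroup (GL (Fin 2) ℝ)} {k : ℤ}

/-- The coefficients of a cusp form damped by `e^{-2πnY}`, `Y > 0`, are bounded (indeed tend to
`0`): the `q`-expansion converges at `iY`. [folklore] -/
theorem isBigO_cuspCoeff_mul_exp (hΓ : (1 : ℝ) ∈ Γ.strictPeriods) (g : CuspForm Γ k) {Y : ℝ}
    (hY : 0 < Y) :
    (fun n : ℕ ↦ cuspCoeff g n * (Real.exp (-(2 * Real.pi * n) * Y) : ℝ)) =O[atTop]
      fun _ ↦ (1 : ℝ) :=
  (hasSum_imagAxis hΓ g hY).summable.tendsto_atTop_zero.isBigO_one ℝ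

/-- Summability of `∑ ‖aₙ‖ e^{-2πnY} / (2πn)` for `Y > 0`. [folklore] -/
theorem summable_norm_cuspCoeff_mul_exp_div (hΓ : (1 : ℝ) ∈ Γ.strictPeriods) (g : CuspForm Γ k)
    {Y : ℝ} (hY : 0 < Y) :
    Summable fun n : ℕ ↦ ‖cuspCoeff g n‖ * (Real.exp (-(2 * Real.pi * n) * Y) / (2 * Real.pi * n)) := by
  have hY2 : 0 < Y / 2 := by positivity
  have h1 := isBigO_cuspCoeff_mul_exp hΓ g hY2
  -- compare with the geometric series `e^{-πnY}`
  have hgeom : Summable fun n : ℕ ↦ Real.exp (-(Real.pi * Y)) ^ n :=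
    summable_geometric_of_lt_one (Real.exp_pos _).le
      (Real.exp_lt_one_iff.mpr (by nlinarith [Real.pi_pos]))
  refine summable_of_isBigO_nat hgeom ?_
  have h2 : (fun n : ℕ ↦ ‖cuspCoeff g n‖ * (Real.exp (-(2 * Real.pi * n) * Y) / (2 * Real.pi * n))) =
      fun n : ℕ ↦ ‖cuspCoeff g n * (Real.exp (-(2 * Real.pi * n) * (Y / 2)) : ℝ)‖ *
        (Real.exp (-(Real.pi * Y)) ^ n / (2 * Real.pi * n)) := by
    funext n
    rw [norm_mul, Complex.norm_real, Real.norm_of_nonneg (Real.exp_pos _).le, ← Real.exp_nat_mul]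
    have : Real.exp (-(2 * Real.pi * n) * Y) =
        Real.exp (-(2 * Real.pi * n) * (Y / 2)) * Real.exp (n * -(Real.pi * Y)) := by
      rw [← Real.exp_add]; ring_nf
    rw [this]; ring
  rw [h2]
  refine (h1.norm_left.mul (isBigO_refl _ _)).trans ?_
  simp only [one_mul]
  refine IsBigO.of_bound 1 ?_
  filter_upwards [eventually_ge_atTop 1] with n hn
  rw [Real.norm_of_nonneg (by positivity), Real.norm_of_nonneg (by positivity), one_mul]
  refine div_le_self (by positivity) ?_
  have : (1 : ℝ) ≤ n := by exact_mod_cast hn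
  nlinarith [Real.two_le_pi]

/-- **Tail of the ray integral as a series**: for a cusp form `g = ∑ aₙ qⁿ` (`1` a strict period)
and `Y > 0`, `∫_Y^∞ g(it) dt = ∑_{n ≥ 1} aₙ e^{-2πnY} / (2πn)`, by termwise integration of the
`q`-expansion (dominated by `∑ ‖aₙ‖ e^{-2πnY}/(2πn) < ∞`). The `n = 0` term vanishes (`a₀ = 0`).
(Cremona, *Algorithms for modular elliptic curves*, §2.10, (2.10.3)–(2.10.5).) [folklore] -/
theorem hasSum_integral_Ioi_imagAxis (hΓ : (1 : ℝ) ∈ Γ.strictPeriods) (g : CuspForm Γ k)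
    {Y : ℝ} (hY : 0 < Y) :
    HasSum (fun n : ℕ ↦ cuspCoeff g n * (Real.exp (-(2 * Real.pi * n) * Y) / (2 * Real.pi * n) : ℝ))
      (∫ t in Ioi Y, g (ofComplex (Complex.I * t))) := by
  have h0 : cuspCoeff g 0 = 0 := cuspCoeff_zero hΓ g
  -- the terms
  set F : ℕ → ℝ → ℂ := fun n t ↦ cuspCoeff g n * (Real.exp (-(2 * Real.pi * n) * t) : ℝ) with hF
  have hF_int : ∀ n : ℕ, Integrable (F n) (volume.restrict (Ioi Y)) := by
    intro n
    rcases Nat.eq_zero_or_pos n with rfl | hn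
    · simp only [hF, h0, zero_mul]
      exact integrable_zero _ _ _
    · have ha : -(2 * Real.pi * n) < (0 : ℝ) := by
        have : (0 : ℝ) < 2 * Real.pi * n := by positivity
        linarith
      exact ((integrableOn_exp_mul_Ioi ha Y).ofReal).const_mul _
  have hF_val : ∀ n : ℕ, ∫ t in Ioi Y, F n t =
      cuspCoeff g n * (Real.exp (-(2 * Real.pi * n) * Y) / (2 * Real.pi * n) : ℝ) := by
    intro n
    rcases Nat.eq_zero_or_pos n with rfl | hn
    · simp [hF, h0]
    · have ha : -(2 * Real.pi * n) < (0 : ℝ) := by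
        have : (0 : ℝ) < 2 * Real.pi * n := by positivity
        linarith
      simp only [hF]
      rw [integral_const_mul, integral_complex_ofReal, integral_exp_mul_Ioi ha Y]
      congr 2
      field_simp
  have hF_norm : ∀ n : ℕ, ∫ t in Ioi Y, ‖F n t‖ =
      ‖cuspCoeff g n‖ * (Real.exp (-(2 * Real.pi * n) * Y) / (2 * Real.pi * n)) := by
    intro n
    rcases Nat.eq_zero_or_pos n with rfl | hn
    · simp [hF, h0]
    · have ha : -(2 * Real.pi * n) < (0 : ℝ) := by
        have : (0 : ℝ) < 2 * Real.pi * n := by positivity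
        linarith
      simp only [hF, norm_mul, Complex.norm_real, Real.norm_of_nonneg (Real.exp_pos _).le]
      rw [integral_const_mul, integral_exp_mul_Ioi ha Y]
      congr 1
      field_simp
  have hsum : Summable fun n : ℕ ↦ ∫ t in Ioi Y, ‖F n t‖ := by
    simp_rw [hF_norm]
    exact summable_norm_cuspCoeff_mul_exp_div hΓ g hY
  have hmain := hasSum_integral_of_summable_integral_norm hF_int hsum
  simp_rw [hF_val] at hmain
  have heq : ∫ t in Ioi Y, (∑' n : ℕ, F n t) = ∫ t in Ioi Y, g (ofComplex (Complex.I * t)) :=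
    setIntegral_congr_fun measurableSet_Ioi fun t ht ↦
      (hasSum_imagAxis hΓ g (hY.trans ht)).tsum_eq
  rwa [heq] at hmain

end Tail

/-! ### The Fricke involution, pointwise, and the flip `u/m + it ↔ v/m + i/(N m² t)` -/

section Flip

variable {N : ℕ} [NeZero N]

/-- `im (-1/(N τ)) > 0` for `τ ∈ ℍ`, `N ≥ 1`. [folklore] -/
theorem im_neg_one_div_pos (τ : ℍ) : 0 < (-1 / ((N : ℂ) * (τ : ℂ))).im := by
  have hN : (0 : ℝ) < N := Nat.cast_pos.mpr (NeZero.pos N)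
  rw [neg_div, Complex.neg_im, one_div, Complex.inv_im, neg_pos, div_neg_iff]
  right
  refine ⟨?_, Complex.normSq_pos.mpr (mul_ne_zero (Nat.cast_ne_zero.mpr (NeZero.ne N))
    (UpperHalfPlane.ne_zero τ))⟩
  rw [Complex.mul_im, Complex.natCast_re, Complex.natCast_im, zero_mul, add_zero, neg_lt_zero]
  exact mul_pos hN τ.im_pos

/-- The **Fricke point** `w_N τ = -1/(Nτ) ∈ ℍ` (the action of `w_N = (0 -1; N 0)` on `ℍ`;
Atkin–Lehner 1970, §2). [cite: AtkinLehner1970, §2] -/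
def frickePoint (N : ℕ) [NeZero N] (τ : ℍ) : ℍ :=
  UpperHalfPlane.mk (-1 / ((N : ℂ) * (τ : ℂ))) (im_neg_one_div_pos τ)

/-- `w_N τ = -1/(Nτ)` as a complex number. [folklore] -/
@[simp] theorem coe_frickePoint (τ : ℍ) : ((frickePoint N τ : ℍ) : ℂ) = -1 / ((N : ℂ) * (τ : ℂ)) :=
  rfl

/-- `w_N τ = ofComplex (-1/(Nτ))`. [folklore] -/
theorem frickePoint_eq_ofComplex (τ : ℍ) :
    frickePoint N τ = ofComplex (-1 / ((N : ℂ) * (τ : ℂ))) := by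
  ext1
  rw [coe_frickePoint, ofComplex_apply_of_im_pos (im_neg_one_div_pos τ)]

/-- **Pointwise Fricke eigen-property** of `f : ℍ → ℂ` in weight `2` with eigenvalue `ε`:
`f(-1/(Nτ)) = ε N τ² f(τ)` for all `τ ∈ ℍ`, i.e. `f ∣[2] w_N = ε f` for `w_N = (0 -1; N 0)`
(`(f ∣[2] w_N)(τ) = det(w_N) (Nτ)^{-2} f(w_N τ) = f(-1/(Nτ))/(Nτ²)`). For a newform on `Γ₀(N)`,
`ε = ±1` is the Fricke (Atkin–Lehner) eigenvalue (Atkin–Lehner 1970, Thm. 3).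
[cite: AtkinLehner1970, §2 and Thm. 3] -/
def IsFrickeEigen (N : ℕ) [NeZero N] (f : ℍ → ℂ) (ε : ℂ) : Prop :=
  ∀ τ : ℍ, f (frickePoint N τ) = ε * N * (τ : ℂ) ^ 2 * f τ

/-- **The flip.** Let `f ∈ S_2(Γ₀(N))` with `f(-1/(Nτ)) = ε N τ² f(τ)`, `m ≥ 1`, and integers
`a, u, v` with `a m - u N v = 1` (so `(u, m) = 1`, `(m, N) = 1` and `v ≡ -(uN)⁻¹ (mod m)`). Then
`γ = (a u; Nv m) ∈ Γ₀(N)` satisfies `[1, u/m; 0, 1] w_{Nm²} = m · γ · w_N · [1, v/m; 0, 1]`, and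
evaluating `f(γ w_N w) = (Nv · w_N w + m)² · ε N w² f(w)` at `w = v/m + i/(N m² t)` gives
`f(u/m + it) = -ε f(v/m + i/(N m² t)) / (N m² t²)` for `t > 0`
(Shimura 1971, proof of Thm. 3.66; Atkin–Li 1978, (1.1)). [folklore] -/
theorem apply_ofComplex_eq_of_isFrickeEigen (f : CuspForm (Gamma0 N) 2) {ε : ℂ}
    (hW : IsFrickeEigen N f ε) {m : ℕ} (hm : 0 < m) {a u v : ℤ}
    (huv : a * m - u * (N * v) = 1) {t : ℝ} (ht : 0 < t) :
    f (ofComplex ((u : ℂ) / m + t * Complex.I)) =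
      -ε / ((N : ℂ) * (m : ℂ) ^ 2 * (t : ℂ) ^ 2) *
        f (ofComplex ((v : ℂ) / m + ((1 / ((N : ℝ) * m ^ 2 * t) : ℝ) : ℂ) * Complex.I)) := by
  -- the point `w = v/m + iT`, `T = 1/(N m² t)`
  have hN0 : (N : ℂ) ≠ 0 := Nat.cast_ne_zero.mpr (NeZero.ne N)
  have hm0 : (m : ℂ) ≠ 0 := Nat.cast_ne_zero.mpr hm.ne'
  have ht0 : (t : ℂ) ≠ 0 := Complex.ofReal_ne_zero.mpr ht.ne'
  set T : ℝ := 1 / ((N : ℝ) * m ^ 2 * t) with hT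
  have hTpos : 0 < T := by
    have : (0 : ℝ) < N := Nat.cast_pos.mpr (NeZero.pos N)
    positivity
  have hTC : (T : ℂ) = 1 / ((N : ℂ) * (m : ℂ) ^ 2 * (t : ℂ)) := by rw [hT]; push_cast; ring
  set w₀ : ℂ := (v : ℂ) / m + (T : ℂ) * Complex.I with hw₀
  have hw₀im : 0 < w₀.im := by simpa [hw₀] using hTpos
  set w : ℍ := ofComplex w₀ with hw
  have hwcoe : (w : ℂ) = w₀ := by rw [hw, ofComplex_apply_of_im_pos hw₀im]
  have hw₀0 : w₀ ≠ 0 := fun h ↦ by rw [h] at hw₀im; simp at hw₀im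
  have key : (m : ℂ) * w₀ - v = Complex.I / ((N : ℂ) * m * t) := by
    rw [hw₀, hTC]; field_simp; ring
  -- the matrix `γ = (a u; Nv m) ∈ Γ₀(N)`
  set γ : SL(2, ℤ) := ⟨!![a, u; (N : ℤ) * v, (m : ℤ)], by
    rw [Matrix.det_fin_two_of]; linear_combination huv⟩ with hγ
  have hγ00 : (γ 0 0 : ℤ) = a := rfl
  have hγ01 : (γ 0 1 : ℤ) = u := rfl
  have hγ10 : (γ 1 0 : ℤ) = N * v := rfl
  have hγ11 : (γ 1 1 : ℤ) = m := rfl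
  have hγmem : γ ∈ Gamma0 N := by
    rw [Gamma0_mem, hγ10]
    push_cast
    rw [ZMod.natCast_self, zero_mul]
  -- the Fricke point `z = w_N w = -1/(N w₀)`
  set z₀ : ℂ := -1 / ((N : ℂ) * w₀) with hz₀
  have hz₀im : 0 < z₀.im := by
    have := im_neg_one_div_pos (N := N) w
    rwa [hwcoe] at this
  have hz : frickePoint N w = ofComplex z₀ := by rw [frickePoint_eq_ofComplex, hwcoe]
  -- modularity under `γ` at `z`, Fricke at `w`
  have hmod := SlashInvariantForm.slash_action_eqn_SL'' f hγmem (ofComplex z₀)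
  have hfr : (f : ℍ → ℂ) (ofComplex z₀) = ε * N * w₀ ^ 2 * f w := by
    rw [← hz, hW w, hwcoe]
  rw [smul_ofComplex γ hz₀im, denom_ofComplex γ hz₀im, hfr] at hmod
  -- the two algebraic identities
  have hden : ((γ 1 0 : ℤ) : ℂ) * z₀ + ((γ 1 1 : ℤ) : ℂ) =
      Complex.I / ((N : ℂ) * m * t * w₀) := by
    rw [hγ10, hγ11, hz₀]
    push_cast
    have : (N : ℂ) * v * (-1 / (N * w₀)) + m = ((m : ℂ) * w₀ - v) / w₀ := by
      field_simp; ring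
    rw [this, key, div_div]
  have hmoeb : moebius γ z₀ = (u : ℂ) / m + t * Complex.I := by
    have hdet : (a : ℂ) * m - u * (N * v) = 1 := by exact_mod_cast huv
    rw [moebius, hden, hγ00, hγ01, div_div_eq_mul_div]
    have h1 : ((a : ℂ) * z₀ + u) * ((N : ℂ) * m * t * w₀) = (u * N * w₀ - a) * m * t := by
      rw [hz₀]; field_simp; ring
    have h2 : ((u : ℂ) * N * w₀ - a) * m * t = -t + u * Complex.I / m := by
      have key' : (m : ℂ) * w₀ = v + Complex.I / ((N : ℂ) * m * t) := by
        rw [← key]; ring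
      have : ((u : ℂ) * N * w₀ - a) * m * t = (u * N * (m * w₀) - a * m) * t := by ring
      rw [this, key']
      field_simp
      linear_combination (-(t : ℂ) * m) * hdet
    rw [h1, h2, div_eq_iff Complex.I_ne_zero]
    ring_nf
    rw [Complex.I_sq]
    ring
  have hsq : (Complex.I / ((N : ℂ) * m * t * w₀)) ^ (2 : ℤ) * (ε * N * w₀ ^ 2) =
      -ε / ((N : ℂ) * (m : ℂ) ^ 2 * (t : ℂ) ^ 2) := by
    rw [zpow_two]
    field_simp
    ring_nf
    rw [Complex.I_sq]
    ring
  rw [hmoeb, hden] at hmod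
  rw [hmod, ← hsq, hw, hw₀]
  ring

end Flip

/-! ### The substitution `t = 1/(Ms)` on `(0, Y]` -/

section Substitution

/-- **Flip substitution.** If `F(t) = c/(M t²) · G(1/(M t))` for `t > 0` (`M > 0`), then
`∫_{(0, Y]} F(t) dt = c ∫_{(1/(MY), ∞)} G(s) ds` (`Y > 0`), by the substitutions `t = 1/x`
(Mathlib `integral_comp_rpow_Ioi` with exponent `-1`) and `x = M s`
(`integral_comp_mul_left_Ioi`); no integrability hypothesis is needed. [folklore] -/
theorem setIntegral_Ioc_eq_of_flip {F G : ℝ → ℂ} {c : ℂ} {M Y : ℝ} (hM : 0 < M) (hY : 0 < Y)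
    (hFG : ∀ t : ℝ, 0 < t → F t = c / (M * t ^ 2 : ℝ) * G (1 / (M * t))) :
    ∫ t in Ioc 0 Y, F t = c * ∫ s in Ioi (1 / (M * Y)), G s := by
  -- Step 1: as an integral over `(0, ∞)` of an indicator
  set h : ℝ → ℂ := (Ioc 0 Y).indicator F with hh
  have h1 : ∫ t in Ioc 0 Y, F t = ∫ t in Ioi 0, h t := by
    rw [hh, setIntegral_indicator measurableSet_Ioc, Set.inter_eq_right.mpr Set.Ioc_subset_Ioi_self]
  -- Step 2: `t = x⁻¹`
  have h2 : ∫ t in Ioi 0, h t = ∫ x in Ioi 0, (|(-1 : ℝ)| * x ^ ((-1 : ℝ) - 1)) • h (x ^ (-1 : ℝ)) :=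
    (integral_comp_rpow_Ioi h (by norm_num : (-1 : ℝ) ≠ 0)).symm
  set K : ℝ → ℂ := (Ici (1 / (M * Y))).indicator G with hK
  have h3 : ∀ x ∈ Ioi (0 : ℝ), (|(-1 : ℝ)| * x ^ ((-1 : ℝ) - 1)) • h (x ^ (-1 : ℝ)) =
      (c / M) * K (M⁻¹ * x) := by
    intro x hx
    rw [mem_Ioi] at hx
    have hx1 : x ^ (-1 : ℝ) = x⁻¹ := Real.rpow_neg_one x
    have hx2 : x ^ ((-1 : ℝ) - 1) = (x ^ 2)⁻¹ := by
      rw [show (-1 : ℝ) - 1 = -(2 : ℕ) by norm_num, Real.rpow_neg hx.le, Real.rpow_natCast]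
    rw [hx1, hx2, abs_neg, abs_one, one_mul, hh, hK, Set.indicator_apply, Set.indicator_apply]
    have hiff : x⁻¹ ∈ Ioc 0 Y ↔ M⁻¹ * x ∈ Ici (1 / (M * Y)) := by
      rw [mem_Ioc, mem_Ici, one_div, mul_inv, inv_le_comm₀ hx hY]
      constructor
      · rintro ⟨-, hxy⟩
        exact mul_le_mul_of_nonneg_left hxy (inv_pos.mpr hM).le
      · intro hxy
        exact ⟨inv_pos.mpr hx, le_of_mul_le_mul_left hxy (inv_pos.mpr hM)⟩
    by_cases hxY : x⁻¹ ∈ Ioc 0 Y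
    · rw [if_pos hxY, if_pos (hiff.mp hxY), hFG _ (inv_pos.mpr hx)]
      have hx0 : (x : ℂ) ≠ 0 := Complex.ofReal_ne_zero.mpr hx.ne'
      have hM0 : (M : ℂ) ≠ 0 := Complex.ofReal_ne_zero.mpr hM.ne'
      rw [show (1 : ℝ) / (M * x⁻¹) = M⁻¹ * x by field_simp, Complex.real_smul]
      push_cast
      field_simp
    · rw [if_neg hxY, if_neg (mt hiff.mpr hxY), smul_zero, mul_zero]
  have h4 : ∫ x in Ioi 0, (|(-1 : ℝ)| * x ^ ((-1 : ℝ) - 1)) • h (x ^ (-1 : ℝ)) =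
      (c / M) * ∫ x in Ioi 0, K (M⁻¹ * x) := by
    rw [setIntegral_congr_fun measurableSet_Ioi h3, integral_const_mul]
  -- Step 3: `x = M s`
  have h5 : ∫ x in Ioi 0, K (M⁻¹ * x) = M * ∫ s in Ioi 0, K s := by
    rw [integral_comp_mul_left_Ioi K 0 (inv_pos.mpr hM), inv_inv, mul_zero, Complex.real_smul]
  have h6 : ∫ s in Ioi 0, K s = ∫ s in Ioi (1 / (M * Y)), G s := by
    rw [hK, setIntegral_indicator measurableSet_Ici, Set.inter_eq_right.mpr
      (Set.Ici_subset_Ioi.mpr (by positivity)), integral_Ici_eq_integral_Ioi]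
  rw [h1, h2, h4, h5, h6]
  have hM0 : (M : ℂ) ≠ 0 := Complex.ofReal_ne_zero.mpr hM.ne'
  field_simp

end Substitution

/-! ### Two-sided series for the ray integrals `{∞, u/m}` -/

section TwoSided

variable {N : ℕ} (f : CuspForm (Gamma0 N) 2)

/-- The **damped twisted sum** `D_f(w, y) = ∑_{n ≥ 1} w(n) aₙ e^{-2πny} / n` of the Fourier
coefficients of `f` against a weight `w : ℕ → ℂ` (`y > 0`; absolutely convergent for bounded `w`,
`summable_dampedTwist`). For `w = χ` a Dirichlet character this is the rapidly convergent series
`∑ χ(n) aₙ n⁻¹ e^{-2πny}` of the approximate functional equation for `L(f ⊗ χ, 1)`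
(Rohrlich 1984, §2; Cremona 1997, §2.13). [folklore] -/
def dampedTwist (w : ℕ → ℂ) (y : ℝ) : ℂ :=
  ∑' n : ℕ, w n * cuspCoeff f n * (Real.exp (-(2 * Real.pi * n) * y) / n : ℝ)

/-- The **damped additive twist** `T_f(q, y) = D_f(e^{2πiq·}, y) = ∑ e^{2πinq} aₙ e^{-2πny}/n`,
the tail `2π ∫_y^∞ f(q + it) dt` of the ray integral (`two_pi_mul_integral_Ioi_eq_rayTail`)
(Cremona 1997, §2.10, (2.10.3)). [folklore] -/
def rayTail (q : ℚ) (y : ℝ) : ℂ :=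
  dampedTwist f (fun n : ℕ ↦ Complex.exp (2 * π * Complex.I * q * n)) y

/-- `1` is a strict period of `Γ₀(N)`. [folklore] -/
theorem one_mem_strictPeriods_Gamma0 : (1 : ℝ) ∈ (Gamma0 N : Subgroup (GL (Fin 2) ℝ)).strictPeriods :=
  strictWidthInfty_Gamma0 N ▸ Subgroup.strictWidthInfty_mem_strictPeriods _

/-- **Absolute convergence of the damped twisted sums** for a bounded weight. [folklore] -/
theorem summable_dampedTwist {w : ℕ → ℂ} {B : ℝ} (hw : ∀ n, ‖w n‖ ≤ B) {y : ℝ} (hy : 0 < y) :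
    Summable fun n : ℕ ↦ w n * cuspCoeff f n * (Real.exp (-(2 * Real.pi * n) * y) / n : ℝ) := by
  have hs := (summable_norm_cuspCoeff_mul_exp_div one_mem_strictPeriods_Gamma0 f hy).mul_left
    (B * (2 * Real.pi))
  refine Summable.of_norm_bounded hs fun n ↦ ?_
  rcases Nat.eq_zero_or_pos n with rfl | hn
  · simp
  · rw [norm_mul, norm_mul, Complex.norm_real, Real.norm_of_nonneg (by positivity)]
    have h1 : ‖w n‖ * ‖cuspCoeff f n‖ ≤ B * ‖cuspCoeff f n‖ :=
      mul_le_mul_of_nonneg_right (hw n) (norm_nonneg _)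
    have h2 : Real.exp (-(2 * Real.pi * n) * y) / n =
        (2 * Real.pi) * (Real.exp (-(2 * Real.pi * n) * y) / (2 * Real.pi * n)) := by
      field_simp
    rw [h2]
    have : 0 ≤ Real.exp (-(2 * Real.pi * n) * y) / (2 * Real.pi * n) := by positivity
    calc ‖w n‖ * ‖cuspCoeff f n‖ * (2 * Real.pi * (Real.exp (-(2 * Real.pi * n) * y) / (2 * Real.pi * n)))
        = (‖w n‖ * ‖cuspCoeff f n‖) * (2 * Real.pi) *
            (Real.exp (-(2 * Real.pi * n) * y) / (2 * Real.pi * n)) := by ring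
      _ ≤ (B * ‖cuspCoeff f n‖) * (2 * Real.pi) *
            (Real.exp (-(2 * Real.pi * n) * y) / (2 * Real.pi * n)) := by gcongr
      _ = _ := by ring

/-- `‖D_f(w, y)‖ ≤ ∑ ‖w n‖ ‖aₙ‖ e^{-2πny}/n` (and the right side converges for bounded `w`).
[folklore] -/
theorem norm_dampedTwist_le {w : ℕ → ℂ} {B : ℝ} (hw : ∀ n, ‖w n‖ ≤ B) {y : ℝ} (hy : 0 < y) :
    ‖dampedTwist f w y‖ ≤
      ∑' n : ℕ, ‖w n‖ * ‖cuspCoeff f n‖ * (Real.exp (-(2 * Real.pi * n) * y) / n) := by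
  rw [dampedTwist]
  refine (norm_tsum_le_tsum_norm (summable_dampedTwist f hw hy).norm).trans (le_of_eq ?_)
  refine tsum_congr fun n ↦ ?_
  rw [norm_mul, norm_mul, Complex.norm_real, Real.norm_of_nonneg (by positivity)]

/-- **The tail of the ray integral is the damped additive twist**:
`2π ∫_y^∞ f(q + it) dt = ∑ e^{2πinq} aₙ e^{-2πny}/n` for `y > 0` (termwise integration of the
`q`-expansion of the translate `f(· + q)`, whose coefficients are `e^{2πinq} aₙ`;
Cremona 1997, §2.10). [folklore] -/
theorem hasSum_rayTail (q : ℚ) {y : ℝ} (hy : 0 < y) :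
    HasSum (fun n : ℕ ↦ Complex.exp (2 * π * Complex.I * q * n) * cuspCoeff f n *
      (Real.exp (-(2 * Real.pi * n) * y) / n : ℝ))
      (2 * Real.pi * ∫ t in Ioi y, f (ofComplex ((q : ℂ) + t * Complex.I))) := by
  have hΓ' : (1 : ℝ) ∈ (toConjAct (upperRightHom (q : ℝ) : GL (Fin 2) ℝ)⁻¹ •
      (Gamma0 N : Subgroup (GL (Fin 2) ℝ))).strictPeriods := by
    rw [strictPeriods_conj_upperRightHom]
    exact one_mem_strictPeriods_Gamma0
  have h := (hasSum_integral_Ioi_imagAxis hΓ' (translateCuspForm f q) hy).mul_left (2 * Real.pi : ℂ)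
  have hint : ∫ t in Ioi y, translateCuspForm f q (ofComplex (Complex.I * t)) =
      ∫ t in Ioi y, f (ofComplex ((q : ℂ) + t * Complex.I)) :=
    setIntegral_congr_fun measurableSet_Ioi fun t ht ↦ imagAxis_translateCuspForm f q (hy.trans ht)
  rw [hint] at h
  have hfun : (fun n : ℕ ↦ (2 * Real.pi : ℂ) * (cuspCoeff (translateCuspForm f q) n *
      (Real.exp (-(2 * Real.pi * n) * y) / (2 * Real.pi * n) : ℝ))) =
      fun n : ℕ ↦ Complex.exp (2 * π * Complex.I * q * n) * cuspCoeff f n *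
        (Real.exp (-(2 * Real.pi * n) * y) / n : ℝ) := by
    funext n
    rw [cuspCoeff_translateCuspForm one_mem_strictPeriods_Gamma0]
    rcases Nat.eq_zero_or_pos n with rfl | hn
    · simp
    · have : (2 * Real.pi : ℂ) ≠ 0 := by exact_mod_cast Real.two_pi_pos.ne'
      push_cast
      field_simp
  rwa [hfun] at h

/-- `2π ∫_y^∞ f(q + it) dt = T_f(q, y)`. [folklore] -/
theorem two_pi_mul_integral_Ioi_eq_rayTail (q : ℚ) {y : ℝ} (hy : 0 < y) :
    2 * Real.pi * ∫ t in Ioi y, f (ofComplex ((q : ℂ) + t * Complex.I)) = rayTail f q y := by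
  rw [rayTail, dampedTwist, ← (hasSum_rayTail f q hy).tsum_eq]

/-- **Two-sided series for `{∞, u/m}_f`** (the "approximate functional equation" in exact form,
weight `2`): for `f ∈ S_2(Γ₀(N))` with `f(-1/(Nτ)) = ε N τ² f(τ)`, `m ≥ 1`, `a m - u N v = 1`
and any `Y > 0`,
`{∞, u/m}_f = 2π ∫₀^∞ f(u/m + it) dt = T_f(u/m, Y) - ε T_f(v/m, 1/(N m² Y))`:
split the ray at height `Y`, flip the lower piece by `apply_ofComplex_eq_of_isFrickeEigen` and
substitute `t = 1/(N m² s)` (Cremona 1997, §2.10, Prop. 2.10.3 for the analogous computation of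
periods; Rohrlich 1984, §2). [folklore] -/
theorem modularSymbol_eq_rayTail_sub [NeZero N] (f : CuspForm (Gamma0 N) 2) {ε : ℂ}
    (hW : IsFrickeEigen N f ε)
    {m : ℕ} (hm : 0 < m) {a u v : ℤ} (huv : a * m - u * (N * v) = 1) {Y : ℝ} (hY : 0 < Y) :
    modularSymbol f ((u : ℚ) / m) =
      rayTail f ((u : ℚ) / m) Y - ε * rayTail f ((v : ℚ) / m) (1 / ((N : ℝ) * m ^ 2 * Y)) := by
  have hN : (0 : ℝ) < N := Nat.cast_pos.mpr (NeZero.pos N)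
  set M : ℝ := (N : ℝ) * m ^ 2 with hM
  have hMpos : 0 < M := by positivity
  have hY' : 0 < 1 / (M * Y) := by positivity
  set F : ℝ → ℂ := fun t ↦ f (ofComplex ((((u : ℚ) / m : ℚ) : ℂ) + t * Complex.I)) with hF
  set G : ℝ → ℂ := fun s ↦ f (ofComplex ((((v : ℚ) / m : ℚ) : ℂ) + s * Complex.I)) with hG
  -- integrability and splitting at `Y`
  have hFint : IntegrableOn F (Ioi 0) := integrableOn_translate_integrand f _
  have hsplit : ∫ t in Ioi 0, F t = (∫ t in Ioc 0 Y, F t) + ∫ t in Ioi Y, F t := by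
    rw [← setIntegral_union (Set.Ioc_disjoint_Ioi le_rfl) measurableSet_Ioi
      (hFint.mono_set Ioc_subset_Ioi_self) (hFint.mono_set (Ioi_subset_Ioi hY.le)),
      Ioc_union_Ioi_eq_Ioi hY.le]
  -- the flipped lower piece
  have hflip : ∫ t in Ioc 0 Y, F t = -ε * ∫ s in Ioi (1 / (M * Y)), G s := by
    refine setIntegral_Ioc_eq_of_flip hMpos hY fun t ht ↦ ?_
    rw [hF, hG]
    dsimp only
    have h := apply_ofComplex_eq_of_isFrickeEigen f hW hm huv ht
    push_cast at h ⊢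
    rw [h, hM]
    push_cast
    ring_nf
  rw [modularSymbol, hsplit, hflip, mul_add, ← two_pi_mul_integral_Ioi_eq_rayTail f _ hY,
    ← two_pi_mul_integral_Ioi_eq_rayTail f _ hY']
  ring

end TwoSided

/-! ### Finite Fourier analysis: the two-sided series for `∑ χ̄(a) {∞, a/m}` -/

section Twist

variable {N : ℕ} [NeZero N] (f : CuspForm (Gamma0 N) 2) {m : ℕ} [NeZero m]

omit [NeZero N] in
/-- `‖e^{2πiqn}‖ = 1`. [folklore] -/
theorem norm_exp_two_pi_mul_I (q : ℚ) (n : ℕ) : ‖Complex.exp (2 * π * Complex.I * q * n)‖ = 1 := by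
  rw [show (2 * π * Complex.I * q * n : ℂ) = ((2 * Real.pi * q * n : ℝ) : ℂ) * Complex.I by
    push_cast; ring, Complex.norm_exp_ofReal_mul_I]

omit [NeZero N] in
/-- A sum over `ℤ/mℤ` of a function vanishing off the units is the sum over `(ℤ/mℤ)ˣ`.
[folklore] -/
theorem sum_eq_sum_units {M : Type*} [AddCommMonoid M] (G : ZMod m → M)
    (hG : ∀ x : ZMod m, ¬ IsUnit x → G x = 0) : ∑ x : ZMod m, G x = ∑ u : (ZMod m)ˣ, G u := by
  classical
  rw [← Finset.sum_filter_of_ne (p := IsUnit) (fun x _ hx ↦ not_imp_comm.mp (hG x) hx)]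
  refine Finset.sum_bij' (fun x hx ↦ (Finset.mem_filter.mp hx).2.unit) (fun u _ ↦ (u : ZMod m))
    (fun x hx ↦ Finset.mem_univ _) (fun u _ ↦ Finset.mem_filter.mpr ⟨Finset.mem_univ _, u.isUnit⟩)
    (fun x hx ↦ IsUnit.unit_spec _) (fun u _ ↦ Units.ext (by simp)) (fun x hx ↦ by simp)

omit [NeZero N] in
/-- **Interchange**: a finite combination of damped additive twists along `x ↦ g(x)/m` is the
damped sum of the corresponding trigonometric sums
`∑_x c(x) T_f(g(x)/m, y) = ∑_{n ≥ 1} (∑_x c(x) e(g(x) n/m)) aₙ e^{-2πny}/n`. [folklore] -/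
theorem sum_mul_rayTail_eq_tsum (c : ZMod m → ℂ) (g : ZMod m → ZMod m) {y : ℝ} (hy : 0 < y) :
    ∑ x : ZMod m, c x * rayTail f (((g x).val : ℚ) / m) y =
      ∑' n : ℕ, (∑ x : ZMod m, c x * (ZMod.stdAddChar (g x * (n : ZMod m)) : ℂ)) * cuspCoeff f n *
        (Real.exp (-(2 * Real.pi * n) * y) / n : ℝ) := by
  have hx : ∀ x ∈ (Finset.univ : Finset (ZMod m)), HasSum (fun n : ℕ ↦ c x *
      (Complex.exp (2 * π * Complex.I * (((g x).val : ℚ) / m : ℚ) * n) * cuspCoeff f n *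
        (Real.exp (-(2 * Real.pi * n) * y) / n : ℝ))) (c x * rayTail f (((g x).val : ℚ) / m) y) := by
    intro x _
    refine (Summable.hasSum ?_).mul_left _
    exact summable_dampedTwist f (fun n ↦ (norm_exp_two_pi_mul_I _ n).le) hy
  rw [← (hasSum_sum hx).tsum_eq]
  refine tsum_congr fun n ↦ ?_
  rw [Finset.sum_mul, Finset.sum_mul]
  refine Finset.sum_congr rfl fun x _ ↦ ?_
  rw [stdAddChar_mul_natCast]
  ring

omit [NeZero N] in
/-- **The flip datum of a unit**: for `x ∈ (ℤ/mℤ)ˣ`, `(m, N) = 1`, and `v ≡ -(xN)⁻¹ (mod m)` (the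
representative of `-(x N)⁻¹` in `[0, m)`), there is `a ∈ ℤ` with `a m - x N v = 1`. [folklore] -/
theorem exists_int_flip (hmN : m.Coprime N) {x : ZMod m} (hx : IsUnit x) :
    ∃ a : ℤ, a * m - (x.val : ℤ) * (N * ((-(x * (N : ZMod m))⁻¹ : ZMod m).val : ℤ)) = 1 := by
  set v : ZMod m := -(x * (N : ZMod m))⁻¹ with hv
  have hN : IsUnit ((N : ℕ) : ZMod m) := (ZMod.isUnit_iff_coprime N m).mpr hmN.symm
  have hxN : IsUnit (x * (N : ZMod m)) := hx.mul hN
  have key : (((1 + (x.val : ℤ) * (N * (v.val : ℤ)) : ℤ)) : ZMod m) = 0 := by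
    push_cast
    rw [ZMod.natCast_zmod_val, ZMod.natCast_zmod_val, hv]
    have h := ZMod.mul_inv_of_unit _ hxN
    linear_combination -h
  obtain ⟨a, ha⟩ := (ZMod.intCast_zmod_eq_zero_iff_dvd _ _).mp key
  exact ⟨a, by linarith⟩

omit [NeZero N] in
/-- **Gauss sum of the flipped points.** For a Dirichlet character `χ` mod `m`, `(m, N) = 1`:
`∑_{x ∈ (ℤ/m)ˣ} χ̄(x) e(-(xN)⁻¹ n/m) = χ̄(-1) χ(N) ∑_x χ(x) e(x n/m)` (substitute `x ↦ -(xN)⁻¹`,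
an involution of `(ℤ/mℤ)ˣ`); the right-hand sum is the Gauss sum `τ(χ, e(n·/m))`. [folklore] -/
theorem sum_inv_mul_stdAddChar_flip (hmN : m.Coprime N) (χ : DirichletCharacter ℂ m) (n : ℕ) :
    ∑ x : ZMod m, χ⁻¹ x * (ZMod.stdAddChar ((-(x * (N : ZMod m))⁻¹) * (n : ZMod m)) : ℂ) =
      χ⁻¹ (-1) * χ N * gaussSum χ ((ZMod.stdAddChar (N := m)).mulShift n) := by
  set Nu : (ZMod m)ˣ := ZMod.unitOfCoprime N hmN.symm with hNu
  have hNucoe : (Nu : ZMod m) = N := ZMod.coe_unitOfCoprime N hmN.symm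
  set φ : (ZMod m)ˣ → (ZMod m)ˣ := fun u ↦ -(u * Nu)⁻¹ with hφ
  have hφinv : Function.Involutive φ := fun u ↦ by
    simp only [hφ]
    simp [mul_inv_rev, mul_comm]
  have hφcoe : ∀ u : (ZMod m)ˣ, ((φ u : (ZMod m)ˣ) : ZMod m) = -((u : ZMod m) * N)⁻¹ := by
    intro u
    rw [hφ]
    dsimp only
    rw [Units.val_neg, ← ZMod.inv_coe_unit, Units.val_mul, hNucoe]
  -- both sides as sums over units
  rw [sum_eq_sum_units (fun x ↦ χ⁻¹ x * (ZMod.stdAddChar ((-(x * (N : ZMod m))⁻¹) * (n : ZMod m)) : ℂ))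
    (fun x hx ↦ by rw [MulChar.map_nonunit _ hx, zero_mul])]
  rw [gaussSum, sum_eq_sum_units (fun x ↦ χ x * (ZMod.stdAddChar (N := m)).mulShift n x)
    (fun x hx ↦ by rw [MulChar.map_nonunit _ hx, zero_mul]), Finset.mul_sum]
  -- reindex by the involution `φ`
  rw [Fintype.sum_equiv (Function.Involutive.toPerm φ hφinv)
    (fun u : (ZMod m)ˣ ↦ χ⁻¹ (u : ZMod m) *
      (ZMod.stdAddChar ((-((u : ZMod m) * (N : ZMod m))⁻¹) * (n : ZMod m)) : ℂ))
    (fun w : (ZMod m)ˣ ↦ χ⁻¹ ((φ w : (ZMod m)ˣ) : ZMod m) *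
      (ZMod.stdAddChar ((w : ZMod m) * (n : ZMod m)) : ℂ))
    (fun u ↦ by
      simp only [Function.Involutive.coe_toPerm]
      rw [hφinv u, hφcoe u])]
  refine Finset.sum_congr rfl fun w _ ↦ ?_
  -- `χ⁻¹ (φ w) = χ⁻¹(-1) χ(N) χ(w)`
  have h1 : χ⁻¹ ((φ w : (ZMod m)ˣ) : ZMod m) = χ⁻¹ (-1) * χ N * χ w := by
    rw [hφ]
    dsimp only
    rw [Units.val_neg, neg_eq_neg_one_mul, map_mul, MulChar.inv_apply χ (((w * Nu)⁻¹ : (ZMod m)ˣ) : ZMod m),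
      Ring.inverse_unit, inv_inv, Units.val_mul, hNucoe, map_mul]
    ring
  rw [h1, AddChar.mulShift_apply, mul_comm (n : ZMod m)]
  ring

omit [NeZero N] in
/-- `∑_x χ̄(x) e(xn/m) = χ(n) τ(χ̄)` for primitive `χ` (Mathlib `gaussSum_mulShift_of_isPrimitive`
for `χ⁻¹`). [folklore] -/
theorem sum_inv_mul_stdAddChar (χ : DirichletCharacter ℂ m) (hχ : χ.IsPrimitive) (n : ℕ) :
    ∑ x : ZMod m, χ⁻¹ x * (ZMod.stdAddChar (x * (n : ZMod m)) : ℂ) =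
      χ n * gaussSum χ⁻¹ (ZMod.stdAddChar (N := m)) := by
  have hχ' : DirichletCharacter.IsPrimitive χ⁻¹ := by
    rw [DirichletCharacter.isPrimitive_def, DirichletCharacter.conductor_inv]; exact hχ
  have h := gaussSum_mulShift_of_isPrimitive (ZMod.stdAddChar (N := m)) hχ' n
  rw [inv_inv, gaussSum] at h
  rw [← h]
  refine Finset.sum_congr rfl fun x _ ↦ ?_
  rw [AddChar.mulShift_apply, mul_comm (n : ZMod m)]

/-- **Two-sided series for the twisted symbol sums** (the exact "approximate functional
equation" for `L(f ⊗ χ, 1)` in weight `2`). Let `f ∈ S_2(Γ₀(N))` satisfy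
`f(-1/(Nτ)) = ε N τ² f(τ)`, let `χ` be a *primitive* Dirichlet character mod `m` with `(m, N) = 1`,
and `Y > 0`. Then
`∑_{a mod m} χ̄(a) {∞, a/m}_f = τ(χ̄) · D_f(χ, Y) - ε · χ̄(-1) χ(N) τ(χ) · D_f(χ̄, 1/(N m² Y))`,
where `D_f(w, y) = ∑ w(n) aₙ e^{-2πny}/n` (`dampedTwist`) and `τ` is the Gauss sum for
`e(x/m)`. By Birch's formula the left side is `τ(χ̄) L(f, χ, 1)` (`twisted_LValue_eq`), and for
even `χ` (`τ(χ)τ(χ̄) = m`) this is Rohrlich's starting point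
`L(f, χ, 1) = ∑ χ(n) aₙ n⁻¹ e^{-2πnY} - ε χ(N) (τ(χ)²/m) ∑ χ̄(n) aₙ n⁻¹ e^{-2πn/(N m² Y)}`
(Rohrlich 1984, §2; Shimura 1971, Thm. 3.66 for the functional equation of `L(f ⊗ χ, s)` behind
it). Proof: `modularSymbol_eq_rayTail_sub` at the units `a`, then `∑_a χ̄(a) e(an/m) = χ(n) τ(χ̄)`
and `∑_a χ̄(a) e(-(aN)⁻¹ n/m) = χ̄(-1) χ(N) χ̄(n) τ(χ)` (`sum_inv_mul_stdAddChar_flip`). [folklore] -/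
theorem twistedSymbolSum_inv_eq_dampedTwist {ε : ℂ} (hW : IsFrickeEigen N f ε) (hmN : m.Coprime N)
    {χ : DirichletCharacter ℂ m} (hχ : χ.IsPrimitive) {Y : ℝ} (hY : 0 < Y) :
    twistedSymbolSum f χ⁻¹ =
      gaussSum χ⁻¹ (ZMod.stdAddChar (N := m)) * dampedTwist f (fun n ↦ χ n) Y -
        ε * (χ⁻¹ (-1) * χ N * gaussSum χ (ZMod.stdAddChar (N := m))) *
          dampedTwist f (fun n ↦ χ⁻¹ n) (1 / ((N : ℝ) * m ^ 2 * Y)) := by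
  have hN : (0 : ℝ) < N := Nat.cast_pos.mpr (NeZero.pos N)
  have hY' : 0 < 1 / ((N : ℝ) * m ^ 2 * Y) := by
    have : (0 : ℝ) < m := Nat.cast_pos.mpr (NeZero.pos m)
    positivity
  set V : ZMod m → ZMod m := fun x ↦ -(x * (N : ZMod m))⁻¹ with hV
  -- the two-sided formula at the units
  have hunit : ∀ x : ZMod m, IsUnit x → modularSymbol f ((x.val : ℚ) / m) =
      rayTail f ((x.val : ℚ) / m) Y - ε * rayTail f (((V x).val : ℚ) / m) (1 / ((N : ℝ) * m ^ 2 * Y)) := by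
    intro x hx
    obtain ⟨a, ha⟩ := exists_int_flip hmN hx
    have h := modularSymbol_eq_rayTail_sub f hW (NeZero.pos m) ha hY
    simpa only [Int.cast_natCast] using h
  -- expand the twisted symbol sum
  have hexp : twistedSymbolSum f χ⁻¹ =
      ∑ x : ZMod m, χ⁻¹ x * rayTail f ((x.val : ℚ) / m) Y -
        ε * ∑ x : ZMod m, χ⁻¹ x * rayTail f (((V x).val : ℚ) / m) (1 / ((N : ℝ) * m ^ 2 * Y)) := by
    rw [twistedSymbolSum, Finset.mul_sum, ← Finset.sum_sub_distrib]
    refine Finset.sum_congr rfl fun x _ ↦ ?_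
    by_cases hx : IsUnit x
    · rw [hunit x hx]; ring
    · rw [MulChar.map_nonunit _ hx]; ring
  have hA : ∑ x : ZMod m, χ⁻¹ x * rayTail f ((x.val : ℚ) / m) Y =
      gaussSum χ⁻¹ (ZMod.stdAddChar (N := m)) * dampedTwist f (fun n ↦ χ n) Y := by
    have h1 := sum_mul_rayTail_eq_tsum f (fun x ↦ χ⁻¹ x) id hY
    simp only [id] at h1
    rw [h1, dampedTwist, ← tsum_mul_left]
    exact tsum_congr fun n ↦ by rw [sum_inv_mul_stdAddChar χ hχ n]; ring
  have hB : ∑ x : ZMod m, χ⁻¹ x * rayTail f (((V x).val : ℚ) / m) (1 / ((N : ℝ) * m ^ 2 * Y)) =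
      (χ⁻¹ (-1) * χ N * gaussSum χ (ZMod.stdAddChar (N := m))) *
        dampedTwist f (fun n ↦ χ⁻¹ n) (1 / ((N : ℝ) * m ^ 2 * Y)) := by
    rw [sum_mul_rayTail_eq_tsum f (fun x ↦ χ⁻¹ x) V hY', dampedTwist, ← tsum_mul_left]
    refine tsum_congr fun n ↦ ?_
    rw [hV]
    dsimp only
    rw [sum_inv_mul_stdAddChar_flip hmN χ n, gaussSum_mulShift_of_isPrimitive _ hχ]
    ring
  rw [hexp, hA, hB]
  ring

end Twist

/-! ### Fricke pairs: the two-sided series without the eigen-assumption -/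

section FrickePair

variable {N : ℕ} [NeZero N]

/-- **Fricke pair** (weight `2`): `g = f ∣[2] w_N` pointwise, i.e. `f(-1/(Nτ)) = N τ² g(τ)` for
all `τ ∈ ℍ` (`(f ∣[2] w_N)(τ) = det(w_N) (Nτ)^{-2} f(w_N τ) = f(-1/(Nτ))/(Nτ²)`). For every
`f ∈ S_2(Γ₀(N))` the form `g = w_N f ∈ S_2(Γ₀(N))` (`frickeInvolution`, pointwise by the named
fact `frickeInvolution_apply_eq_slash` of `CuspFormLFunction`) makes `(f, g)` a Fricke pair, with
no eigen-assumption on `f`; and `IsFrickeEigen N f ε ↔ IsFrickePair N f (ε • f)`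
(`isFrickePair_smul_iff`) (Atkin–Lehner 1970, §2). [cite: AtkinLehner1970, §2] -/
def IsFrickePair (N : ℕ) [NeZero N] (f g : ℍ → ℂ) : Prop :=
  ∀ τ : ℍ, f (frickePoint N τ) = N * (τ : ℂ) ^ 2 * g τ

/-- `f` is a `w_N`-eigenfunction with eigenvalue `ε` iff `(f, ε f)` is a Fricke pair. [folklore] -/
theorem isFrickePair_smul_iff {f : ℍ → ℂ} {ε : ℂ} :
    IsFrickePair N f (ε • f) ↔ IsFrickeEigen N f ε := by
  refine forall_congr' fun τ ↦ ?_
  rw [Pi.smul_apply, smul_eq_mul, show (N : ℂ) * (τ : ℂ) ^ 2 * (ε * f τ) =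
    ε * N * (τ : ℂ) ^ 2 * f τ by ring]

/-- A `w_N`-eigenfunction gives the Fricke pair `(f, ε f)`. [folklore] -/
theorem IsFrickeEigen.isFrickePair {f : ℍ → ℂ} {ε : ℂ} (h : IsFrickeEigen N f ε) :
    IsFrickePair N f (ε • f) :=
  isFrickePair_smul_iff.mpr h

/-- **The flip for a Fricke pair.** Let `f ∈ S_2(Γ₀(N))`, `g : ℍ → ℂ` with
`f(-1/(Nτ)) = N τ² g(τ)`, `m ≥ 1`, and integers `a, u, v` with `a m - u N v = 1`. Then
`f(u/m + it) = -g(v/m + i/(N m² t)) / (N m² t²)` for `t > 0`: with `γ = (a u; Nv m) ∈ Γ₀(N)`,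
`[1, u/m; 0, 1] w_{Nm²} = m · γ · w_N · [1, v/m; 0, 1]`, and one evaluates
`f(γ w_N w) = (Nv · w_N w + m)² · N w² g(w)` at `w = v/m + i/(N m² t)` (as in
`apply_ofComplex_eq_of_isFrickeEigen`, which is the case `g = ε f`; Shimura 1971, proof of
Thm. 3.66; Atkin–Li 1978, (1.1)). [folklore] -/
theorem apply_ofComplex_eq_of_isFrickePair (f : CuspForm (Gamma0 N) 2) {g : ℍ → ℂ}
    (hW : IsFrickePair N f g) {m : ℕ} (hm : 0 < m) {a u v : ℤ}
    (huv : a * m - u * (N * v) = 1) {t : ℝ} (ht : 0 < t) :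
    f (ofComplex ((u : ℂ) / m + t * Complex.I)) =
      -1 / ((N : ℂ) * (m : ℂ) ^ 2 * (t : ℂ) ^ 2) *
        g (ofComplex ((v : ℂ) / m + ((1 / ((N : ℝ) * m ^ 2 * t) : ℝ) : ℂ) * Complex.I)) := by
  -- the point `w = v/m + iT`, `T = 1/(N m² t)`
  have hN0 : (N : ℂ) ≠ 0 := Nat.cast_ne_zero.mpr (NeZero.ne N)
  have hm0 : (m : ℂ) ≠ 0 := Nat.cast_ne_zero.mpr hm.ne'
  have ht0 : (t : ℂ) ≠ 0 := Complex.ofReal_ne_zero.mpr ht.ne'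
  set T : ℝ := 1 / ((N : ℝ) * m ^ 2 * t) with hT
  have hTpos : 0 < T := by
    have : (0 : ℝ) < N := Nat.cast_pos.mpr (NeZero.pos N)
    positivity
  have hTC : (T : ℂ) = 1 / ((N : ℂ) * (m : ℂ) ^ 2 * (t : ℂ)) := by rw [hT]; push_cast; ring
  set w₀ : ℂ := (v : ℂ) / m + (T : ℂ) * Complex.I with hw₀
  have hw₀im : 0 < w₀.im := by simpa [hw₀] using hTpos
  set w : ℍ := ofComplex w₀ with hw
  have hwcoe : (w : ℂ) = w₀ := by rw [hw, ofComplex_apply_of_im_pos hw₀im]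
  have hw₀0 : w₀ ≠ 0 := fun h ↦ by rw [h] at hw₀im; simp at hw₀im
  have key : (m : ℂ) * w₀ - v = Complex.I / ((N : ℂ) * m * t) := by
    rw [hw₀, hTC]; field_simp; ring
  -- the matrix `γ = (a u; Nv m) ∈ Γ₀(N)`
  set γ : SL(2, ℤ) := ⟨!![a, u; (N : ℤ) * v, (m : ℤ)], by
    rw [Matrix.det_fin_two_of]; linear_combination huv⟩ with hγ
  have hγ00 : (γ 0 0 : ℤ) = a := rfl
  have hγ01 : (γ 0 1 : ℤ) = u := rfl
  have hγ10 : (γ 1 0 : ℤ) = N * v := rfl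
  have hγ11 : (γ 1 1 : ℤ) = m := rfl
  have hγmem : γ ∈ Gamma0 N := by
    rw [Gamma0_mem, hγ10]
    push_cast
    rw [ZMod.natCast_self, zero_mul]
  -- the Fricke point `z = w_N w = -1/(N w₀)`
  set z₀ : ℂ := -1 / ((N : ℂ) * w₀) with hz₀
  have hz₀im : 0 < z₀.im := by
    have := im_neg_one_div_pos (N := N) w
    rwa [hwcoe] at this
  have hz : frickePoint N w = ofComplex z₀ := by rw [frickePoint_eq_ofComplex, hwcoe]
  -- modularity under `γ` at `z`, the Fricke pair at `w`
  have hmod := SlashInvariantForm.slash_action_eqn_SL'' f hγmem (ofComplex z₀)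
  have hfr : (f : ℍ → ℂ) (ofComplex z₀) = N * w₀ ^ 2 * g w := by
    rw [← hz, hW w, hwcoe]
  rw [smul_ofComplex γ hz₀im, denom_ofComplex γ hz₀im, hfr] at hmod
  -- the two algebraic identities
  have hden : ((γ 1 0 : ℤ) : ℂ) * z₀ + ((γ 1 1 : ℤ) : ℂ) =
      Complex.I / ((N : ℂ) * m * t * w₀) := by
    rw [hγ10, hγ11, hz₀]
    push_cast
    have : (N : ℂ) * v * (-1 / (N * w₀)) + m = ((m : ℂ) * w₀ - v) / w₀ := by
      field_simp; ring
    rw [this, key, div_div]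
  have hmoeb : moebius γ z₀ = (u : ℂ) / m + t * Complex.I := by
    have hdet : (a : ℂ) * m - u * (N * v) = 1 := by exact_mod_cast huv
    rw [moebius, hden, hγ00, hγ01, div_div_eq_mul_div]
    have h1 : ((a : ℂ) * z₀ + u) * ((N : ℂ) * m * t * w₀) = (u * N * w₀ - a) * m * t := by
      rw [hz₀]; field_simp; ring
    have h2 : ((u : ℂ) * N * w₀ - a) * m * t = -t + u * Complex.I / m := by
      have key' : (m : ℂ) * w₀ = v + Complex.I / ((N : ℂ) * m * t) := by
        rw [← key]; ring
      have : ((u : ℂ) * N * w₀ - a) * m * t = (u * N * (m * w₀) - a * m) * t := by ring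
      rw [this, key']
      field_simp
      linear_combination (-(t : ℂ) * m) * hdet
    rw [h1, h2, div_eq_iff Complex.I_ne_zero]
    ring_nf
    rw [Complex.I_sq]
    ring
  have hsq : (Complex.I / ((N : ℂ) * m * t * w₀)) ^ (2 : ℤ) * (N * w₀ ^ 2) =
      -1 / ((N : ℂ) * (m : ℂ) ^ 2 * (t : ℂ) ^ 2) := by
    rw [zpow_two]
    field_simp
    ring_nf
    rw [Complex.I_sq]
  rw [hmoeb, hden] at hmod
  rw [hmod, ← hsq, hw, hw₀]
  ring

/-- **Two-sided series for `{∞, u/m}_f`, Fricke-pair form**: for `f, g ∈ S_2(Γ₀(N))` with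
`f(-1/(Nτ)) = N τ² g(τ)`, `m ≥ 1`, `a m - u N v = 1` and any `Y > 0`,
`{∞, u/m}_f = T_f(u/m, Y) - T_g(v/m, 1/(N m² Y))` (split the ray at height `Y`, flip the lower
piece onto `g` by `apply_ofComplex_eq_of_isFrickePair`, substitute `t = 1/(N m² s)`; the case
`g = ε f` is `modularSymbol_eq_rayTail_sub`) (Cremona 1997, §2.10; Rohrlich 1984, §2).
[folklore] -/
theorem modularSymbol_eq_rayTail_sub_of_isFrickePair (f g : CuspForm (Gamma0 N) 2)
    (hW : IsFrickePair N f g)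
    {m : ℕ} (hm : 0 < m) {a u v : ℤ} (huv : a * m - u * (N * v) = 1) {Y : ℝ} (hY : 0 < Y) :
    modularSymbol f ((u : ℚ) / m) =
      rayTail f ((u : ℚ) / m) Y - rayTail g ((v : ℚ) / m) (1 / ((N : ℝ) * m ^ 2 * Y)) := by
  have hN : (0 : ℝ) < N := Nat.cast_pos.mpr (NeZero.pos N)
  set M : ℝ := (N : ℝ) * m ^ 2 with hM
  have hMpos : 0 < M := by positivity
  have hY' : 0 < 1 / (M * Y) := by positivity
  set F : ℝ → ℂ := fun t ↦ f (ofComplex ((((u : ℚ) / m : ℚ) : ℂ) + t * Complex.I)) with hF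
  set G : ℝ → ℂ := fun s ↦ g (ofComplex ((((v : ℚ) / m : ℚ) : ℂ) + s * Complex.I)) with hG
  -- integrability and splitting at `Y`
  have hFint : IntegrableOn F (Ioi 0) := integrableOn_translate_integrand f _
  have hsplit : ∫ t in Ioi 0, F t = (∫ t in Ioc 0 Y, F t) + ∫ t in Ioi Y, F t := by
    rw [← setIntegral_union (Set.Ioc_disjoint_Ioi le_rfl) measurableSet_Ioi
      (hFint.mono_set Ioc_subset_Ioi_self) (hFint.mono_set (Ioi_subset_Ioi hY.le)),
      Ioc_union_Ioi_eq_Ioi hY.le]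
  -- the flipped lower piece
  have hflip : ∫ t in Ioc 0 Y, F t = (-1) * ∫ s in Ioi (1 / (M * Y)), G s := by
    refine setIntegral_Ioc_eq_of_flip hMpos hY fun t ht ↦ ?_
    rw [hF, hG]
    dsimp only
    have h := apply_ofComplex_eq_of_isFrickePair f hW hm huv ht
    push_cast at h ⊢
    rw [h, hM]
    push_cast
    ring_nf
  rw [modularSymbol, hsplit, hflip, mul_add, ← two_pi_mul_integral_Ioi_eq_rayTail f _ hY,
    ← two_pi_mul_integral_Ioi_eq_rayTail g _ hY']
  ring

variable (f g : CuspForm (Gamma0 N) 2) {m : ℕ} [NeZero m]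

/-- **Two-sided series for the twisted symbol sums, Fricke-pair form.** Let `f, g ∈ S_2(Γ₀(N))`
with `f(-1/(Nτ)) = N τ² g(τ)` (e.g. `g = w_N f`), `χ` a *primitive* Dirichlet character mod `m`
with `(m, N) = 1`, and `Y > 0`. Then
`∑_{a mod m} χ̄(a) {∞, a/m}_f = τ(χ̄) · D_f(χ, Y) - χ̄(-1) χ(N) τ(χ) · D_g(χ̄, 1/(N m² Y))`
(the case `g = ε f` is `twistedSymbolSum_inv_eq_dampedTwist`; Rohrlich 1984, §2; Shimura 1971,
Thm. 3.66). Proof: `modularSymbol_eq_rayTail_sub_of_isFrickePair` at the units, then the two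
Gauss-sum evaluations `sum_inv_mul_stdAddChar`, `sum_inv_mul_stdAddChar_flip`. [folklore] -/
theorem twistedSymbolSum_inv_eq_dampedTwist_of_isFrickePair (hW : IsFrickePair N f g)
    (hmN : m.Coprime N) {χ : DirichletCharacter ℂ m} (hχ : χ.IsPrimitive) {Y : ℝ} (hY : 0 < Y) :
    twistedSymbolSum f χ⁻¹ =
      gaussSum χ⁻¹ (ZMod.stdAddChar (N := m)) * dampedTwist f (fun n ↦ χ n) Y -
        (χ⁻¹ (-1) * χ N * gaussSum χ (ZMod.stdAddChar (N := m))) *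
          dampedTwist g (fun n ↦ χ⁻¹ n) (1 / ((N : ℝ) * m ^ 2 * Y)) := by
  have hN : (0 : ℝ) < N := Nat.cast_pos.mpr (NeZero.pos N)
  have hY' : 0 < 1 / ((N : ℝ) * m ^ 2 * Y) := by
    have : (0 : ℝ) < m := Nat.cast_pos.mpr (NeZero.pos m)
    positivity
  set V : ZMod m → ZMod m := fun x ↦ -(x * (N : ZMod m))⁻¹ with hV
  -- the two-sided formula at the units
  have hunit : ∀ x : ZMod m, IsUnit x → modularSymbol f ((x.val : ℚ) / m) =
      rayTail f ((x.val : ℚ) / m) Y - rayTail g (((V x).val : ℚ) / m) (1 / ((N : ℝ) * m ^ 2 * Y)) := by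
    intro x hx
    obtain ⟨a, ha⟩ := exists_int_flip hmN hx
    have h := modularSymbol_eq_rayTail_sub_of_isFrickePair f g hW (NeZero.pos m) ha hY
    simpa only [Int.cast_natCast] using h
  -- expand the twisted symbol sum
  have hexp : twistedSymbolSum f χ⁻¹ =
      ∑ x : ZMod m, χ⁻¹ x * rayTail f ((x.val : ℚ) / m) Y -
        ∑ x : ZMod m, χ⁻¹ x * rayTail g (((V x).val : ℚ) / m) (1 / ((N : ℝ) * m ^ 2 * Y)) := by
    rw [twistedSymbolSum, ← Finset.sum_sub_distrib]
    refine Finset.sum_congr rfl fun x _ ↦ ?_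
    by_cases hx : IsUnit x
    · rw [hunit x hx]; ring
    · rw [MulChar.map_nonunit _ hx]; ring
  have hA : ∑ x : ZMod m, χ⁻¹ x * rayTail f ((x.val : ℚ) / m) Y =
      gaussSum χ⁻¹ (ZMod.stdAddChar (N := m)) * dampedTwist f (fun n ↦ χ n) Y := by
    have h1 := sum_mul_rayTail_eq_tsum f (fun x ↦ χ⁻¹ x) id hY
    simp only [id] at h1
    rw [h1, dampedTwist, ← tsum_mul_left]
    exact tsum_congr fun n ↦ by rw [sum_inv_mul_stdAddChar χ hχ n]; ring
  have hB : ∑ x : ZMod m, χ⁻¹ x * rayTail g (((V x).val : ℚ) / m) (1 / ((N : ℝ) * m ^ 2 * Y)) =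
      (χ⁻¹ (-1) * χ N * gaussSum χ (ZMod.stdAddChar (N := m))) *
        dampedTwist g (fun n ↦ χ⁻¹ n) (1 / ((N : ℝ) * m ^ 2 * Y)) := by
    rw [sum_mul_rayTail_eq_tsum g (fun x ↦ χ⁻¹ x) V hY', dampedTwist, ← tsum_mul_left]
    refine tsum_congr fun n ↦ ?_
    rw [hV]
    dsimp only
    rw [sum_inv_mul_stdAddChar_flip hmN χ n, gaussSum_mulShift_of_isPrimitive _ hχ]
    ring
  rw [hexp, hA, hB]

end FrickePair

end Literature.NumberTheory.EllipticCurves.ModularForms
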